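import Summits.QuantumFields.YangMills.Theorems.BalabanUVNodesN15KingModelThm33AtRegularFieldRegionDatum

/-!
# Route «BalabanUVNodes», node N15 = NE2 — THE KING-MODEL RUNG, PART Θ⁺⁺-a′: THE DATUM OF KING 1986 THEOREM 3.3 ON A REGION AT A REGULAR FIELD
# **WITH THE PARALLEL-TRANSPORT CONTOURS AS A PARAMETER** (`U(A(Γ_{y,x}))` along a given contour system `Γ`; PART Θ⁺⁺-a's `kingThm33DataOn` is the
# instance `Γ = contourK`)

Cell `pub-ymgap`, Track A (D-0062), seat `pub-ymgap-dag-n15-e` (R141 (C), s3), generation 21.  `bears_on: R4∕N15`; `--supports stmt-QuantumFields-27366`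
(K3⁸, `--as helper`).  COUNT-NEUTRAL.  Namespace `…N15KingModelRung.Curved`.

WHY.  King's (3.8) transports `D^η_{A,μ}G_k(Ω, A)f(x)` to `y` by `U(A(Γ_{y,x}))` along a coordinate contour `Γ_{y,x}` ((2.12) p. 653); [Ba1] Prop. 2.1
p. 610 takes «a shortest contour connecting these points».  PART Θ⁺ fixed ONE admissible staircase `contourK y x` on the torus (p26's `exists_isAdm`,
chosen by `Classical.choose`).  On a REGION the tree's `R₀`-free box theorem for (2.24) (`B1Ineq224RegularBox`) wants the contour INSIDE `Ω`, which an
abstractly chosen torus staircase need not be; so the region∕box files (PARTS Θ⁺⁺-b∕c, Θ⁺⁺⁺) are typed for an ARBITRARY admissible contour system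
`Γ` (`IsAdm y x (Γ y x)`: a nearest-neighbour chain from `y` to `x` with `|Γ| ≤ d|x − y|`), and the box assembly asks `Γ_{y,x} ⊂ Ω` — a satisfiable,
geometric hypothesis (for a product of cell intervals at most half the torus the coordinatewise shortest staircase qualifies — PART Θ⁺⁺⁺-d
`…IntervalBox`).

WHAT THIS FILE PROVES (0 `sorry`; one dictionary `def`).  ★ `kingThm33DataAlong C P k Ω V Γ A a m²` — PART Θ⁺⁺-a's datum with `transport y x :=
hol C A y (Γ y x)`; `kingThm33DataOn_eq_along : kingThm33DataOn C P k Ω V A a m² = kingThm33DataAlong C P k Ω V (fun y x => contourK y x) A a m²` (`rfl`).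
[cite: King1986, (2.12) p.653, Thm 3.3 (3.8) p.656] [cite: Balaban1982Higgs1, Prop. 2.1 (2.24) p.610]

HONEST FRAMING ∕ SCOPE.  Dictionary plumbing only; scope as PART Θ⁺⁺-a.  NOT Bałaban's non-abelian `G(U)`; NE2⁺ NOT printed ∕ not proved; NOT a node
discharge; counts untouched; nothing continuum ∕ ℝ⁴ ∕ OS ∕ mass-gap ∕ Clay.
-/

noncomputable section

namespace Summit.QuantumFields.YangMills.BalabanUVNodes.N15KingModelRung.Curved

open Literature.MathematicalPhysics.QuantumFieldTheory.Balaban1983to89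
open Literature.MathematicalPhysics.QuantumFieldTheory.Balaban1983to89.HiggsLattice (ChargeData covDeriv)
open Literature.MathematicalPhysics.QuantumFieldTheory.Balaban1983to89.HiggsCovariance (propagatorK)
open Literature.MathematicalPhysics.QuantumFieldTheory.Balaban1983to89.HiggsCondCov232 (condCov232)
open Literature.MathematicalPhysics.QuantumFieldTheory.Balaban1983to89.B1Eq230FluctCov (deltaKA)
open Literature.MathematicalPhysics.QuantumFieldTheory.Balaban1983to89.B1TorusChainTransport (hol)
open Literature.MathematicalPhysics.QuantumFieldTheory.Balaban1983to89.B1TorusRegionRop (chi)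
open Literature.MathematicalPhysics.QuantumFieldTheory.Balaban1983to89.B1Ineq234Concrete (distC)
open Literature.MathematicalPhysics.QuantumFieldTheory.King1986.ContinuumLimit (Thm33Data)

variable {N : ℕ}

/-- ★ **THE DATUM OF KING's THEOREM 3.3 ON A REGION `Ω` AT THE FIELD `A`, FINE CARRIER `V`, TRANSPORTS ALONG THE CONTOUR SYSTEM `Γ`** (PART Θ⁺⁺-a's
`kingThm33DataOn` with `U(A(Γ_{y,x}))` read along `Γ y x`). [cite: King1986, (2.12) p.653, Thm 3.3 (3.6)–(3.8) pp.655–656]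
[cite: Balaban1982Higgs1, (2.22), (2.24), (2.26) p.610, (2.31)–(2.32), (2.37) pp.611–612] -/
def kingThm33DataAlong (C : ChargeData N) (P : HiggsLattice.Params) (k : ℕ) (Ω V : Finset (HiggsLattice.Site P 0))
    (Γ : HiggsLattice.Site P 0 → HiggsLattice.Site P 0 → List (HiggsLattice.Site P 0)) (A : HiggsLattice.VecField P 0)
    (a msq : ℝ) : Thm33Data P.d (USite k Ω) (VSite V) (EuclideanSpace ℝ (Fin N)) where
  distk x y := (HiggsLattice.Site.tdist x.1 y.1 : ℝ)
  distη x y := (HiggsLattice.Site.tdist x.1 y.1 : ℝ) / (P.L : ℝ) ^ k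
  dsupp f x := sdistI x f / (P.L : ℝ) ^ k
  dsupp2 f x y := min (sdistI x f) (sdistI y f) / (P.L : ℝ) ^ k
  dbdryk x y := min (distC (unitRegion k Ω) x.1) (distC (unitRegion k Ω) y.1)
  dbdryη x y := min (bdistΩ Ω x.1) (bdistΩ Ω y.1) / (P.L : ℝ) ^ k
  dsuppbdry f := sbdistI Ω f / (P.L : ℝ) ^ k
  supNorm f := ‖f‖
  transport y x := hol C A y.1 (Γ y.1 x.1)
  lapK x y := P.mesh k ^ 2 * blockNormK (deltaKA C Ω A msq a k) x.1 y.1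
  covK x y := (P.mesh k ^ 2)⁻¹ * blockNormK (condCov232 C Ω A msq a k (unitRegion k Ω)) x.1 y.1
  δcovK x y := (P.mesh k ^ 2)⁻¹ *
    blockNormK (condCov232 C Ω A msq a k (unitRegion k Ω) - condCov232 C Finset.univ A msq a k Finset.univ) x.1 y.1
  G f := fun x => (P.mesh k ^ 2)⁻¹ • propagatorK C Ω A msq a k (chi Ω • extI f) x.1
  DG μ f := fun x => (P.mesh k)⁻¹ • covDeriv C A (propagatorK C Ω A msq a k (chi Ω • extI f)) ⟨x.1, μ⟩
  δG f := fun x => (P.mesh k ^ 2)⁻¹ •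
    (propagatorK C Ω A msq a k (chi Ω • extI f) - propagatorK C Finset.univ A msq a k (chi (Finset.univ : Finset (HiggsLattice.Site P 0)) • extI f)) x.1
  δDG μ f := fun x => (P.mesh k)⁻¹ •
    covDeriv C A (propagatorK C Ω A msq a k (chi Ω • extI f) - propagatorK C Finset.univ A msq a k (chi (Finset.univ : Finset (HiggsLattice.Site P 0)) • extI f)) ⟨x.1, μ⟩

/-- PART Θ⁺⁺-a's datum is the instance `Γ = contourK` (Θ⁺'s torus staircases). [cite: King1986, Thm 3.3 (3.8) p.656] -/
theorem kingThm33DataOn_eq_along {P : HiggsLattice.Params} (C : ChargeData N) (k : ℕ) (Ω V : Finset (HiggsLattice.Site P 0))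
    (A : HiggsLattice.VecField P 0) (a msq : ℝ) :
    kingThm33DataOn C P k Ω V A a msq = kingThm33DataAlong C P k Ω V (fun y x => contourK y x) A a msq := rfl

end Summit.QuantumFields.YangMills.BalabanUVNodes.N15KingModelRung.Curved

end
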